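import Mathlib
import Summits.ResolutionOfSingularities.ResolutionOfSingularities.Theorems.HomologicalConductorPersistenceSurfaceSaturationResidualFourCompletionDoor
import Summits.ResolutionOfSingularities.ResolutionOfSingularities.Theorems.HomologicalConductorPersistenceSurfaceFirstStep
import HarnessLib

/-!
# Rung S-2 `PersistenceSurface` (stmt-ResolutionOfSingularities-19970) — the saturation stub in ONE first-step
# hypothesis: `Sat₄(loc A)` for the two-dimensional `loc A` with singular successor that are NON-NORMAL or have a
# NON-GORENSTEIN COMPLETION

Route `ResolutionOfSingularities/HomologicalConductor`, chain W4.4b, rung S-2 `PersistenceSurface`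
(stmt-ResolutionOfSingularities-19970), registered skeleton 1a77c002, stub
`stub_saturationFourSurfaceResidualFour : SaturationFourSurfaceResidual₄`.  [OURS · bookkeeping over LANDED tree lemmas;
AI-written, weaker than expert review; NOT a statement of the manuscript under study (Hironaka 2017).]  DEF-FREE.

Composition of hand leafhand-res-homologicalconduct-4's FG re-basing (`exists_fg_model_tower_eq`,
`ringKrullDim_le_of_models`, p798937: every stage is stage `0` of an admissible finitely generated model) with this
hand's completion door (`saturationFourSurfaceResidual₄_of_stageZero_nonnormal_of_nonGorensteinCompletion`, p807962 +
append): the registered stub follows from ONE statement about the local ring `loc A = T₀` of an admissible surface datum —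

* `saturationFourSurfaceResidual₄_of_firstStep_nonnormal_or_nonGorensteinCompletion` — `SaturationFourSurfaceResidual₄` ⇐
  «for every admissible `(A, O)` with `dim A ≤ 2` such that `loc A` is not regular, not a monic-hypersurface
  localisation, not an edim-candidate, of Krull dimension `2`, with `T₁` singular, AND (`loc A` is not integrally closed
  OR the `𝔪`-adic completion of `loc A` is not Gorenstein): `ca(loc A) ⊆ ca⁴(loc A)`»;
* `persistenceSurface_of_firstStep_nonnormal_or_nonGorensteinCompletion_of_completedStep'_of_restSingular` — the route
  decl BY NAME from that statement, CSP‴ and (L′) at singular steps.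

This is the exact remaining content of the saturation stub after p794975 (Gorenstein stages), p807481/p807685 (complete
intersections of any codimension, by equation count), p807841 (completion door) and p807962.
-/

noncomputable section

-- single-problem summit: the doubled namespace component `ResolutionOfSingularities` is forced
set_option linter.dupNamespace false

namespace Summit.ResolutionOfSingularities.ResolutionOfSingularities.Theorems.HomologicalConductor.PersistenceSurfaceSaturationFirstStepCompletionDoor

open CategoryTheory CategoryTheory.Abelian IsLocalRing Literature.RingTheory.CohomologyAnnihilator
open Summit.ResolutionOfSingularities.ResolutionOfSingularities.Theorems
open Summit.ResolutionOfSingularities.ResolutionOfSingularities.Theorems.NoZeno.Birth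
open Summit.ResolutionOfSingularities.ResolutionOfSingularities.Theorems.HomologicalConductor.PersistenceSurfaceSaturationResidual
open Summit.ResolutionOfSingularities.ResolutionOfSingularities.Theorems.HomologicalConductor.PersistenceSurfaceSaturationResidualThree
open Summit.ResolutionOfSingularities.ResolutionOfSingularities.Theorems.HomologicalConductor.PersistenceSurfaceSaturationResidualFour
open Summit.ResolutionOfSingularities.ResolutionOfSingularities.Theorems.HomologicalConductor.PersistenceSurfaceSaturationResidualFourCompletionDoor
open Summit.ResolutionOfSingularities.ResolutionOfSingularities.Theorems.HomologicalConductor.PersistenceSurfaceCompletedStepLevelFree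
open Summit.ResolutionOfSingularities.ResolutionOfSingularities.Theorems.HomologicalConductor.PersistenceSurfaceLevelFreeRestSingular
open Summit.ResolutionOfSingularities.ResolutionOfSingularities.Theorems.HomologicalConductor.PersistenceSurfaceFirstStep

/-- **The saturation stub from ONE first-step hypothesis.**  `SaturationFourSurfaceResidual₄` follows from `Sat₄(loc A)`
for every admissible surface datum whose `loc A` satisfies the residual clauses (not regular, not a monic-hypersurface
localisation, not an edim-candidate, Krull dimension `2`, `T₁` singular) AND is either NOT integrally closed or has a
NON-Gorenstein `𝔪`-adic completion (`¬ ∀ W f.g., ∀ i ≥ 3, Extⁱ_{(loc A)^}(W, (loc A)^) = 0`).  Stage `m` of `(A, O)` is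
stage `0` of the re-based model `(A_m, O)` (`exists_fg_model_tower_eq`), of Krull dimension `≤ 2`
(`ringKrullDim_le_of_models`). [cite: BahlekehHakimianSalarianTakahashi2015, Thm. 4.5; BrunsHerzog1998, Thm. 3.3.10] -/
theorem saturationFourSurfaceResidual₄_of_firstStep_nonnormal_or_nonGorensteinCompletion
    (hF : ∀ p : ℕ, p.Prime → ∀ (k K : Type) [Field k] [CharP k p] [Field K] [Algebra k K]
      (O : ValuationSubring K) (A : Subalgebra k K), (∀ c : k, algebraMap k K c ∈ O) → A.FG →
      IsFractionRing ↥A K → A.toSubring ≤ O.toSubring → ringKrullDim ↥A ≤ 2 →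
      ∀ [IsLocalRing ↥(tower O A 0)],
      (¬ IsIntegrallyClosed ↥(tower O A 0) ∨
        ¬ (∀ (W : ModuleCat.{0} (AdicCompletion (maximalIdeal ↥(tower O A 0)) ↥(tower O A 0))),
            Module.Finite (AdicCompletion (maximalIdeal ↥(tower O A 0)) ↥(tower O A 0)) W → ∀ i : ℕ, 3 ≤ i →
            ∀ e : CategoryTheory.Abelian.Ext.{0} W
              (ModuleCat.of (AdicCompletion (maximalIdeal ↥(tower O A 0)) ↥(tower O A 0))
                (AdicCompletion (maximalIdeal ↥(tower O A 0)) ↥(tower O A 0))) i, e = 0)) →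
      ¬ IsRegularLocalRing ↥(tower O A 0) → ¬ IsMonicHypersurfaceLocalization k 2 ↥(tower O A 0) →
      ¬ IsEdimHypersurfaceCandidate 2 ↥(tower O A 0) → ¬ IsRegularLocalRing ↥(tower O A 1) →
      ringKrullDim ↥(tower O A 0) = (2 : ℕ) →
      {x : K | ∃ hx : x ∈ tower O A 0, ∃ n : ℕ, ∀ i : ℕ, n ≤ i → ∀ (M N : ModuleCat.{0} ↥(tower O A 0)),
          Module.Finite ↥(tower O A 0) M → Module.Finite ↥(tower O A 0) N →
            ∀ e : CategoryTheory.Abelian.Ext.{0} M N i, (⟨x, hx⟩ : ↥(tower O A 0)) • e = 0} ⊆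
        {x : K | ∃ hx : x ∈ tower O A 0, ∀ i : ℕ, 4 ≤ i → ∀ (M N : ModuleCat.{0} ↥(tower O A 0)),
          Module.Finite ↥(tower O A 0) M → Module.Finite ↥(tower O A 0) N →
            ∀ e : CategoryTheory.Abelian.Ext.{0} M N i, (⟨x, hx⟩ : ↥(tower O A 0)) • e = 0}) :
    SaturationFourSurfaceResidual₄ := by
  refine saturationFourSurfaceResidual₄_of_stageZero_nonnormal_of_nonGorensteinCompletion ?_ ?_
  · intro p hp k K _ _ _ _ O A hk hA hfr hAO hdim hnn hreg hmon hcand hsucc hdim2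
    haveI : IsLocalRing ↥(tower O A 0) := by
      obtain ⟨B, hBO, hTB⟩ := exists_tower_eq_loc O A hk hAO 0
      rw [hTB, loc_eq_locAt]; exact SyzygyFlattening.isLocalRing_locAt O B hBO
    exact hF p hp k K O A hk hA hfr hAO hdim (Or.inl hnn) hreg hmon hcand hsucc hdim2
  · intro p hp k K _ _ _ _ O A hk hA hfr hAO hdim m hnorm inst hGor hreg hmon hcand hsucc hdim2
    haveI := hfr
    obtain ⟨Am, hAmfg, -, hAmO, hAmfr, h0, h1, -⟩ := exists_fg_model_tower_eq O A hA hfr hAO m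
    have hdim' : ringKrullDim ↥Am ≤ 2 := ringKrullDim_le_of_models A Am hA hAmfg hAmfr hdim
    -- keep the instance binder of `hF` un-instantiated while re-basing along `h0`, `h1`
    have h := @hF p hp k K _ _ _ _ O Am hk hAmfg hAmfr hAmO hdim'
    rw [h0, h1] at h
    exact h (Or.inr hGor) hreg hmon hcand hsucc hdim2

/-- **Door of record, first-step form with the completion reading.**  `PersistenceSurface` (the route decl, by name)
from: the first-step saturation hypothesis of the previous theorem, CSP‴, and (L′) on Σ6 ∪ Σ8 at the steps into a
singular stage from a two-dimensional stage (p795210).  Every premise is a hypothesis.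
[cite: BahlekehHakimianSalarianTakahashi2015, Thm. 4.5; IyengarTakahashi2014, §2] -/
theorem persistenceSurface_of_firstStep_nonnormal_or_nonGorensteinCompletion_of_completedStep'_of_restSingular
    (hF : ∀ p : ℕ, p.Prime → ∀ (k K : Type) [Field k] [CharP k p] [Field K] [Algebra k K]
      (O : ValuationSubring K) (A : Subalgebra k K), (∀ c : k, algebraMap k K c ∈ O) → A.FG →
      IsFractionRing ↥A K → A.toSubring ≤ O.toSubring → ringKrullDim ↥A ≤ 2 →
      ∀ [IsLocalRing ↥(tower O A 0)],
      (¬ IsIntegrallyClosed ↥(tower O A 0) ∨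
        ¬ (∀ (W : ModuleCat.{0} (AdicCompletion (maximalIdeal ↥(tower O A 0)) ↥(tower O A 0))),
            Module.Finite (AdicCompletion (maximalIdeal ↥(tower O A 0)) ↥(tower O A 0)) W → ∀ i : ℕ, 3 ≤ i →
            ∀ e : CategoryTheory.Abelian.Ext.{0} W
              (ModuleCat.of (AdicCompletion (maximalIdeal ↥(tower O A 0)) ↥(tower O A 0))
                (AdicCompletion (maximalIdeal ↥(tower O A 0)) ↥(tower O A 0))) i, e = 0)) →
      ¬ IsRegularLocalRing ↥(tower O A 0) → ¬ IsMonicHypersurfaceLocalization k 2 ↥(tower O A 0) →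
      ¬ IsEdimHypersurfaceCandidate 2 ↥(tower O A 0) → ¬ IsRegularLocalRing ↥(tower O A 1) →
      ringKrullDim ↥(tower O A 0) = (2 : ℕ) →
      {x : K | ∃ hx : x ∈ tower O A 0, ∃ n : ℕ, ∀ i : ℕ, n ≤ i → ∀ (M N : ModuleCat.{0} ↥(tower O A 0)),
          Module.Finite ↥(tower O A 0) M → Module.Finite ↥(tower O A 0) N →
            ∀ e : CategoryTheory.Abelian.Ext.{0} M N i, (⟨x, hx⟩ : ↥(tower O A 0)) • e = 0} ⊆
        {x : K | ∃ hx : x ∈ tower O A 0, ∀ i : ℕ, 4 ≤ i → ∀ (M N : ModuleCat.{0} ↥(tower O A 0)),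
          Module.Finite ↥(tower O A 0) M → Module.Finite ↥(tower O A 0) N →
            ∀ e : CategoryTheory.Abelian.Ext.{0} M N i, (⟨x, hx⟩ : ↥(tower O A 0)) • e = 0})
    (hC : CompletedStepPersistenceRationalNormal')
    (hL : ∀ p : ℕ, p.Prime → ∀ (k K : Type) [Field k] [CharP k p] [Field K] [Algebra k K]
      (O : ValuationSubring K) (A : Subalgebra k K), (∀ c : k, algebraMap k K c ∈ O) → A.FG →
      IsFractionRing ↥A K → A.toSubring ≤ O.toSubring → ringKrullDim ↥A ≤ 2 →
      ¬ ((IsIntegrallyClosed ↥(tower O A 0) ∧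
          Literature.AlgebraicGeometry.Resolution.HasRationalSingularity ↥(tower O A 0)) ∨
        IsRegularLocalRing ↥(tower O A 0)) →
      ∀ m : ℕ, ¬ IsRegularLocalRing ↥(tower O A (m + 1)) → ringKrullDim ↥(tower O A m) = (2 : ℕ) →
      {x : K | ∃ hx : x ∈ tower O A m, ∀ i : ℕ, 4 ≤ i → ∀ (M N : ModuleCat.{0} ↥(tower O A m)),
          Module.Finite ↥(tower O A m) M → Module.Finite ↥(tower O A m) N →
            ∀ e : CategoryTheory.Abelian.Ext.{0} M N i, (⟨x, hx⟩ : ↥(tower O A m)) • e = 0} ⊆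
        ca (tower O A (m + 1))) :
    Summit.ResolutionOfSingularities.ResolutionOfSingularities.Theses.HomologicalConductor.PersistenceSurface :=
  persistenceSurface_of_residual₄_of_completedStep'_of_rest'
    (saturationFourSurfaceResidual₄_of_firstStep_nonnormal_or_nonGorensteinCompletion hF) hC
    (levelFourPersistenceNonnormalOrNonrational'_of_singularSucc hL)

end Summit.ResolutionOfSingularities.ResolutionOfSingularities.Theorems.HomologicalConductor.PersistenceSurfaceSaturationFirstStepCompletionDoor

end
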